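import Summits.CriticalPhenomena.CardyFormulaZ2.Theorems.CardyMagicRigidityNestingRigidityPinchLocality
import Summits.CriticalPhenomena.CardyFormulaZ2.Theorems.CardyMagicRigidityNestingRigidityFourArmCouplingTQuenched
import HarnessLib

/-!
# `FourArmCouplingT` from quenched bounds on the colourings of the ring `Λ_{2n}(x) ∖ Λ_n(x)`

Crux `Summit.CriticalPhenomena.CardyFormulaZ2.Theses.CardyMagicRigidity.NestingRigidity`
(stmt-CriticalPhenomena-4835), line `pinch-resampling` v2 (definitions module
`CardyMagicRigidityPinchResamplingDefs`), helper toward the registered stub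
`stub_fourArmCouplingT : FourArmCouplingT` (S2: exterior forgetting, in total variation, for critical site
percolation on `𝕋` conditioned on the pinch event `TPinch x y m n`).

`fourArmCouplingT_of_cylinders` (registered anchor; converse `cylinders_of_fourArmCouplingT`): `FourArmCouplingT`
follows from the quenched
exterior-forgetting bound for the CYLINDER events `localCylinder (Λ_{2n}(x) ∖ Λ_n(x)) ζ` of the finite ring
alone — every colouring `ζ` of the ring (a boundary condition at radius `n` together with the outer halves of
the arms), ONE reference value `ν` per interior event `E` — because an arbitrary exterior event `F`
(determined off `Λ_n(x)`, possibly by infinitely many sites) acts on the cylinders of the ring as the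
nonnegative weights `P(F_ζ)` (`quenched_of_cylinders`, conditional independence of the inside and the outside
given the ring under the product measure), and the quenched form gives the cross-multiplied form
(`fourArmCouplingT_of_quenched`).  Ingredients on the pinch event: its locality and measurability
(`tPinch_determinedBy`, `measurableSet_tPinch`, `tBall_finite`, `tBall_subset_tBall` of `…PinchLocality`).

This is the finite-dimensional statement in which a coupling property à la Garban–Pete–Schramm
(arXiv:1008.1378, Prop. 11 — printed for FOUR-FACE boundary data `Θ`) has to be supplied to close stub S2:
for ALL ring colourings `ζ`, i.e. for boundary data with any number of faces.
-/

noncomputable section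

namespace Summit.CriticalPhenomena.CardyFormulaZ2.Cruxes.NestingRigidity.PinchResampling

open MeasureTheory Set Literature.Probability.Percolation Literature.Probability.LatticeModels

/-! ## `FourArmCouplingT` from quenched bounds on ring patterns -/

section RingPatterns

/-- **Reduction of stub S2 to boundary patterns (registered helper).**  It suffices to prove the quenched
exterior-forgetting bound for the CYLINDER events of the ring `Λ_{2n}(x) ∖ Λ_n(x)`, i.e. for every fixed
colouring `ζ` of the ring (a boundary condition at radius `n` together with the outer half of the arms), with a
reference value `ν` depending on the interior event `E` but not on `ζ`: then the bound holds for every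
exterior event `F` (which acts on the cylinders as the nonnegative weights `P(F_ζ)`, `quenched_of_cylinders`),
and `FourArmCouplingT` follows (`fourArmCouplingT_of_quenched`, both in `…FourArmCouplingTQuenched`).
This is the finite-dimensional form in which
the coupling property of Garban–Pete–Schramm (arXiv:1008.1378, Prop. 11: four-face boundary data) would have to
be supplied — for ALL ring patterns `ζ`. -/
theorem fourArmCouplingT_of_cylinders : (∀ b : ℝ, 0 < b → ∃ M : ℕ, ∀ (x y : Site 2) (m s n : ℕ), m ≤ s → 2 * triNorm (y - x) + 2 * s ≤ n → M * s ≤ n → ∀ E : Set (SiteConfig (Site 2)), MeasurableSet E → DeterminedBy E (tInt y s) → ∃ ν : ℝ, ∀ ζ : Set (Site 2), |(triSitePercolation half).real (E ∩ TPinch x y m n ∩ localCylinder (tBall x (2 * n) \ tBall x n) ζ) - ν * (triSitePercolation half).real (TPinch x y m n ∩ localCylinder (tBall x (2 * n) \ tBall x n) ζ)| ≤ b / 2 * (triSitePercolation half).real (TPinch x y m n ∩ localCylinder (tBall x (2 * n) \ tBall x n) ζ)) → FourArmCouplingT := by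
  intro hC
  refine fourArmCouplingT_of_quenched fun b hb ↦ ?_
  obtain ⟨M, hM⟩ := hC b hb
  refine ⟨M, fun x y m s n hms hn hMn E hEm hE ↦ ?_⟩
  obtain ⟨ν, hν⟩ := hM x y m s n hms hn hMn E hEm hE
  refine ⟨ν, fun F hFm hF ↦ ?_⟩
  set R : Finset (Site 2) :=
    ((tBall_finite x (2 * n)).subset (show tBall x (2 * n) \ tBall x n ⊆ tBall x (2 * n) from fun _ hv ↦ hv.1)).toFinset
    with hRdef
  have hR : (↑R : Set (Site 2)) = tBall x (2 * n) \ tBall x n := by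
    rw [hRdef, Set.Finite.coe_toFinset]
  have hsub : tBall y s ⊆ tBall x (2 * n) := by
    refine tBall_subset_tBall ?_
    have := triNorm_nonneg (y - x)
    omega
  have hdisj : Disjoint (tBall x (2 * n) \ ↑R) (tBall x n)ᶜ := by
    rw [hR, Set.sdiff_sdiff_right_self]
    exact disjoint_compl_right.mono_left inter_subset_right
  have h := quenched_of_cylinders half hdisj hEm (measurableSet_tPinch x y m n) hFm (hE.mono hsub)
    ((tPinch_determinedBy x y m n).mono fun _ hv ↦ hv.1) hF (ν := ν) (c := b / 2) (by rw [hR]; exact hν)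
  exact h

/-- **Conversely, `FourArmCouplingT` gives the quenched bound on every cylinder of the ring** (cylinders are
exterior events: measurable, and determined by the ring, which lies off `Λ_n(x)`), with reference value
`ν = P(E ∩ Pinch) / P(Pinch)` and constant `b` (`quenched_of_fourArmCouplingT`).  So stub S2 is EQUIVALENT to
quenched exterior forgetting over the colourings `ζ` of the ring `Λ_{2n}(x) ∖ Λ_n(x)`. -/
theorem cylinders_of_fourArmCouplingT (h : FourArmCouplingT) (b : ℝ) (hb : 0 < b) :
    ∃ M : ℕ, ∀ (x y : Site 2) (m s n : ℕ), m ≤ s → 2 * triNorm (y - x) + 2 * s ≤ n → M * s ≤ n →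
      ∀ E : Set (SiteConfig (Site 2)), MeasurableSet E → DeterminedBy E (tInt y s) → ∃ ν : ℝ, ∀ ζ : Set (Site 2),
        |(triSitePercolation half).real (E ∩ TPinch x y m n ∩ localCylinder (tBall x (2 * n) \ tBall x n) ζ) -
            ν * (triSitePercolation half).real (TPinch x y m n ∩ localCylinder (tBall x (2 * n) \ tBall x n) ζ)| ≤
          b * (triSitePercolation half).real (TPinch x y m n ∩ localCylinder (tBall x (2 * n) \ tBall x n) ζ) := by
  obtain ⟨M, hM⟩ := quenched_of_fourArmCouplingT h b hb
  refine ⟨M, fun x y m s n hms hn hMn E hEm hE ↦ ?_⟩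
  obtain ⟨ν, hν⟩ := hM x y m s n hms hn hMn E hEm hE
  refine ⟨ν, fun ζ ↦ hν _ ?_ ?_⟩
  · exact measurableSet_localCylinder ((tBall_finite x (2 * n)).subset fun _ hv ↦ hv.1).countable ζ
  · exact (determinedBy_localCylinder _ ζ).mono fun _ hv ↦ hv.2

end RingPatterns

end Summit.CriticalPhenomena.CardyFormulaZ2.Cruxes.NestingRigidity.PinchResampling

end
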